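import Literature.NumberTheory.Sieve.MaynardNFCounting2
import Literature.NumberTheory.Sieve.MaynardNFJunk
import HarnessLib

/-!
# The Maynard–Tao sieve over `𝓞_K`: regrouping the error of Lemma 2.3 by the modulus

Topic `Literature/NumberTheory/Sieve`. Second half of the number-field port of the tree's
`Sieve/MaynardSieveCounting2.lean`, following A. Castillo, C. Hall, R. J. Lemke Oliver, P. Pollack,
L. Thompson, *Bounded gaps between primes in number fields and function fields*, Proc. AMS 143
(2015) = arXiv:1403.5808, proof of Lemma 2.3 (p. 8): "For any `𝔮`, there are at most `τ_{3k}(𝔮)`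
ways to choose `k`-tuples `𝔡₁,…,𝔡_k, 𝔢₁,…,𝔢_k` such that `𝔴 ∏ᵢ [𝔡ᵢ, 𝔢ᵢ] = 𝔮` … the modulus `𝔮`
satisfies `|𝔮| ≤ |𝔴|R²`. Thus, the error term contributes no more than
`y_max² (log R)^{2k} ∑_{|𝔮| < R²|𝔴|} μ(𝔮)² τ_{3k}(𝔮) 𝓔(N; 𝔮)`." Everything here is PROVED.

* `squarefree_inf`, `squarefree_mul_of_sup_eq_top` (and `MaynardNFJunk.squarefree_prod_of_pairwise'`),
  `squarefree_qmod` (the modulus `𝔴∏[𝔡ᵢ,𝔢ᵢ]` of a compatible good pair is squarefree for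
  squarefree `𝔴`), `absNorm_qmod_le` (`N𝔮 ≤ N𝔴 · X²`);
* `omegaI 𝔮 = ω(𝔮)` (number of distinct prime factors), `card_idealDivisors_le_two_pow_omegaI`
  (`τ(𝔮) ≤ 2^{ω(𝔮)}` for squarefree `𝔮`, via `SquarefreeIdeal.prodIdeal`);
* **`sum_pairs_le_sum_moduli`** — for `f ≥ 0`,
  `Σ'_{𝔡,𝔢 good, ∏N𝔡ᵢ ≤ X, ∏N𝔢ᵢ ≤ X} f(𝔴∏[𝔡ᵢ,𝔢ᵢ]) ≤ Σ_{𝔮 squarefree, N𝔮 ≤ N𝔴 X²} (4^k)^{ω(𝔮)} f(𝔮)`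
  (the fibres have at most `τ(𝔮)^{2k} ≤ (4^k)^{ω(𝔮)}` elements — the paper's `τ_{3k}(𝔮)`);
* `modErr` (`𝓔(N;𝔮) + shift(𝔮)`), `pairErr_le`, `abs_lam_mul_pairErr_le`,
  **`sum_lam_pairErr_le`** — the error of `abs_S2_sub_main_le` regrouped:
  `∑_{𝔡,𝔢} |λ_𝔡λ_𝔢| pairErr ≤ λ_max² ∑_{𝔮 sqfree, N𝔮 ≤ N𝔴X²} (4^k)^{ω(𝔮)} modErr(𝔮)
   + λ_max² (#boxG)² C_u (1 + log((2+c)N))^{r}`;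
* `primesAErr_le_of_uniformCount` (the trivial bound `𝓔(N;𝔮) ≪ N^d/φ(𝔮)`),
  `sum_pow_omegaI_div_idealTotient_le` (`∑ c^{ω(𝔮)}/φ(𝔮) ≪ (log x)^c`),
  **`PrimesHaveLevel.sum_pow_omegaI_mul_primesAErr_le`** — the level-of-distribution step
  (Cauchy–Schwarz): `∑_{𝔮 sqfree ≤ Q} c^{ω(𝔮)} 𝓔(N;𝔮) ≤ C N^d/(log N)^A` for `Q ≤ |A(N)|^θ`.


## References

* Castillo–Hall–Lemke Oliver–Pollack–Thompson, arXiv:1403.5808, proof of Lemma 2.3 (p. 8).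
  [CastilloEtAl2015]
* J. Maynard, *Small gaps between primes*, Ann. of Math. 181 (2015), proof of Lemma 5.2 (p. 11).
  [MaynardAnnals2015]
-/

noncomputable section

open Finset UniqueFactorizationMonoid IsDedekindDomain NumberField
open scoped NumberField Classical

namespace Literature.NumberTheory.Sieve.MaynardNF

open UniqueFactorizationMonoid Literature.NumberTheory.LFunctions
  Literature.NumberTheory.LFunctions.NumberField Literature.NumberTheory.Sieve.SquarefreeIdeal Module

open scoped nonZeroDivisors

variable {K : Type*} [Field K] [NumberField K]
variable {k : ℕ}

/-! ### Squarefree moduli -/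

/-- The lcm `𝔞 ∩ 𝔟` of squarefree ideals is squarefree: `𝔞 ∩ 𝔟 = 𝔞'𝔟` with `𝔞 = 𝔤𝔞'`,
`𝔤 = 𝔞 + 𝔟`, `𝔞' + 𝔟 = (1)` (Mathlib's `Ideal.sup_mul_inf`). [folklore] -/
theorem squarefree_inf {𝔞 𝔟 : Ideal (𝓞 K)} (ha : Squarefree 𝔞) (hb : Squarefree 𝔟) :
    Squarefree (𝔞 ⊓ 𝔟) := by
  set 𝔤 := 𝔞 ⊔ 𝔟 with hg
  have ha0 : 𝔞 ≠ 0 := ha.ne_zero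
  have hg0 : 𝔤 ≠ 0 := by
    intro h0
    rw [Ideal.zero_eq_bot] at h0
    exact ha0 (by rw [Ideal.zero_eq_bot]; exact le_bot_iff.1 (h0 ▸ (le_sup_left : 𝔞 ≤ 𝔤)))
  obtain ⟨𝔞', ha'⟩ : 𝔤 ∣ 𝔞 := Ideal.dvd_iff_le.2 le_sup_left
  obtain ⟨𝔟', hb'⟩ : 𝔤 ∣ 𝔟 := Ideal.dvd_iff_le.2 le_sup_right
  have hga : 𝔤 ⊔ 𝔞' = ⊤ :=
    sup_eq_top_of_squarefree_mul (𝔯 := 𝔤) (𝔪 := 𝔞') (by rw [← ha']; exact ha)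
  have hab' : 𝔞' ⊔ 𝔟' = ⊤ := by
    by_contra hne
    obtain ⟨M, hM, hle⟩ := Ideal.exists_le_maximal _ hne
    have hMa' : 𝔞' ≤ M := le_sup_left.trans hle
    have hMb' : 𝔟' ≤ M := le_sup_right.trans hle
    have hMa : 𝔞 ≤ M := by rw [ha']; exact Ideal.mul_le_left.trans hMa'
    have hMb : 𝔟 ≤ M := by rw [hb']; exact Ideal.mul_le_left.trans hMb'
    have hMg : 𝔤 ≤ M := sup_le hMa hMb
    have : 𝔤 ⊔ 𝔞' ≤ M := sup_le hMg hMa'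
    rw [hga, top_le_iff] at this
    exact hM.ne_top this
  have hinf : 𝔞 ⊓ 𝔟 = 𝔞' * 𝔟 := by
    have h := Ideal.sup_mul_inf 𝔞 𝔟
    rw [← hg] at h
    have h2 : 𝔤 * (𝔞 ⊓ 𝔟) = 𝔤 * (𝔞' * 𝔟) := by
      rw [h, ha']; ring
    exact mul_left_cancel₀ hg0 h2
  have ha'b : 𝔞' ⊔ 𝔟 = ⊤ := by
    rw [hb', sup_comm, mul_sup_eq_top_iff]
    exact ⟨hga, by rwa [sup_comm] at hab'⟩
  rw [hinf, squarefree_mul_iff]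
  exact ⟨Ideal.isRelPrime_iff_sup_eq_top.2 ha'b, ha.squarefree_of_dvd ⟨𝔤, by rw [ha', mul_comm]⟩, hb⟩

/-- Comaximal squarefree ideals have a squarefree product. [folklore] -/
theorem squarefree_mul_of_sup_eq_top {𝔞 𝔟 : Ideal (𝓞 K)} (ha : Squarefree 𝔞) (hb : Squarefree 𝔟)
    (h : 𝔞 ⊔ 𝔟 = ⊤) : Squarefree (𝔞 * 𝔟) :=
  squarefree_mul_iff.2 ⟨Ideal.isRelPrime_iff_sup_eq_top.2 h, ha, hb⟩


/-- **The modulus `𝔮 = 𝔴 ∏ᵢ [𝔡ᵢ, 𝔢ᵢ]` of a compatible good pair is squarefree** (for squarefree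
`𝔴`): "`∑_{|𝔮|<R²|𝔴|} μ(𝔮)² τ_{3k}(𝔮) 𝓔(N;𝔮)`". [cite: CastilloEtAl2015, proof of Lemma 2.3] -/
theorem squarefree_qmod {𝔴 : Ideal (𝓞 K)} (h𝔴 : Squarefree 𝔴) {𝔡 𝔢 : Fin k → Ideal (𝓞 K)}
    (hd : IsGood 𝔴 𝔡) (he : IsGood 𝔴 𝔢) (hc : ∀ p : OffDiag k, 𝔡 p.1.1 ⊔ 𝔢 p.1.2 = ⊤) :
    Squarefree (𝔴 * ∏ i, (𝔡 i ⊓ 𝔢 i)) := by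
  have h𝔴0 : 𝔴 ≠ ⊥ := fun h0 => h𝔴.ne_zero (h0.trans Ideal.zero_eq_bot.symm)
  obtain ⟨-, -, -, -, hLW, hLL⟩ := exists_crt_class h𝔴0 hd he hc (fun _ => (0 : 𝓞 K)) 0
  refine squarefree_mul_of_sup_eq_top h𝔴
    (squarefree_prod_of_pairwise' Finset.univ (fun i => 𝔡 i ⊓ 𝔢 i)
      (fun i _ => squarefree_inf (hd.squarefree_apply i) (he.squarefree_apply i))
      (fun i _ j _ hij => hLL i j hij)) ?_
  exact Ideal.sup_prod_eq_top fun i _ => by rw [sup_comm]; exact hLW i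

/-- `N(𝔴∏[𝔡ᵢ,𝔢ᵢ]) ≤ N𝔴 · (∏N𝔡ᵢ)(∏N𝔢ᵢ)` for squarefree entries ("the modulus `𝔮` satisfies
`|𝔮| ≤ |𝔴|R²`"). [cite: CastilloEtAl2015, proof of Lemma 2.3] -/
theorem absNorm_qmod_le (𝔴 : Ideal (𝓞 K)) {𝔡 𝔢 : Fin k → Ideal (𝓞 K)}
    (hd : ∀ i, Squarefree (𝔡 i)) (he : ∀ i, Squarefree (𝔢 i)) :
    (Ideal.absNorm (𝔴 * ∏ i, (𝔡 i ⊓ 𝔢 i)) : ℝ) ≤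
      Ideal.absNorm 𝔴 * ((∏ i, (Ideal.absNorm (𝔡 i) : ℝ)) * ∏ i, (Ideal.absNorm (𝔢 i) : ℝ)) := by
  rw [map_mul, map_prod, Nat.cast_mul, Nat.cast_prod, ← Finset.prod_mul_distrib]
  exact mul_le_mul_of_nonneg_left (Finset.prod_le_prod (fun i _ => Nat.cast_nonneg _)
    fun i _ => absNorm_inf_le_mul (hd i) (he i)) (Nat.cast_nonneg _)

/-! ### Divisors of a squarefree modulus -/

/-- `ω(𝔮)`, the number of distinct prime ideal factors. [folklore] -/
def omegaI (𝔮 : Ideal (𝓞 K)) : ℕ := (normalizedFactors 𝔮).toFinset.card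

/-- `ω(∏_{𝔭 ∈ S} 𝔭) = #S`. [folklore] -/
theorem omegaI_prodIdeal (S : Finset (HeightOneSpectrum (𝓞 K))) :
    omegaI (prodIdeal S) = S.card := by
  rw [omegaI, normalizedFactors_prodIdeal]
  have : (Multiset.map HeightOneSpectrum.asIdeal S.val).toFinset = S.image HeightOneSpectrum.asIdeal := by
    ext I; simp [Finset.mem_image]
  rw [this, Finset.card_image_of_injective _ (fun v w h => HeightOneSpectrum.ext h)]

/-- **`τ(𝔮) ≤ 2^{ω(𝔮)}` for squarefree `𝔮 ≠ 0`**: every divisor of `∏_{𝔭 ∈ S} 𝔭` is `∏_{𝔭 ∈ T} 𝔭`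
for some `T ⊆ S`. [folklore] -/
theorem card_idealDivisors_le_two_pow_omegaI {𝔮 : Ideal (𝓞 K)} (h0 : 𝔮 ≠ ⊥) (hsq : Squarefree 𝔮) :
    (idealDivisors K 𝔮).card ≤ 2 ^ omegaI 𝔮 := by
  have h0' : 𝔮 ≠ 0 := by rwa [Ne, Ideal.zero_eq_bot]
  obtain ⟨S, hS⟩ := exists_eq_prodIdeal_of_squarefree h0' hsq
  have hsub : idealDivisors K 𝔮 ⊆ S.powerset.image prodIdeal := by
    intro B hB
    have hBdvd : B ∣ 𝔮 := (mem_idealDivisors h0).1 hB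
    have hB0 : B ≠ 0 := fun h => h0' (by
      rw [h] at hBdvd; exact zero_dvd_iff.1 hBdvd)
    obtain ⟨T, rfl⟩ := exists_eq_prodIdeal_of_squarefree hB0 (hsq.squarefree_of_dvd hBdvd)
    refine Finset.mem_image.2 ⟨T, Finset.mem_powerset.2 fun v hv => ?_, rfl⟩
    have h1 : v.asIdeal ∣ prodIdeal S := by
      rw [← hS]
      exact (dvd_prodIdeal_iff.2 hv).trans hBdvd
    exact dvd_prodIdeal_iff.1 h1
  calc (idealDivisors K 𝔮).card ≤ (S.powerset.image prodIdeal).card := Finset.card_le_card hsub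
    _ ≤ S.powerset.card := Finset.card_image_le
    _ = 2 ^ omegaI 𝔮 := by rw [Finset.card_powerset, hS, omegaI_prodIdeal]

/-! ### Regrouping by the modulus -/

/-- **Regrouping by the modulus** ("For any `𝔮`, there are at most `τ_{3k}(𝔮)` ways to choose
`𝔡₁,…,𝔡_k, 𝔢₁,…,𝔢_k` such that `𝔴 ∏ [𝔡ᵢ,𝔢ᵢ] = 𝔮`"; here the cruder `τ(𝔮)^{2k} ≤ (4^k)^{ω(𝔮)}`):
for `f ≥ 0` and squarefree `𝔴`,
`Σ'_{𝔡,𝔢 good, ∏N𝔡ᵢ ≤ X, ∏N𝔢ᵢ ≤ X} f(𝔴∏[𝔡ᵢ,𝔢ᵢ]) ≤ Σ_{𝔮 squarefree, 0 < N𝔮 ≤ N𝔴·X²} (4^k)^{ω(𝔮)} f(𝔮)`.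
[cite: CastilloEtAl2015, proof of Lemma 2.3 (τ_{3k}(𝔮), |𝔮| ≤ |𝔴|R²)] -/
theorem sum_pairs_le_sum_moduli {𝔴 : Ideal (𝓞 K)} (h𝔴 : Squarefree 𝔴) {B X : ℝ}
    {f : Ideal (𝓞 K) → ℝ} (hf : ∀ 𝔮, 0 ≤ f 𝔮) :
    ∑ de ∈ ((boxG K k 𝔴 B) ×ˢ (boxG K k 𝔴 B)).filter (fun de =>
        (∀ p : OffDiag k, de.1 p.1.1 ⊔ de.2 p.1.2 = ⊤) ∧ ∏ i, (Ideal.absNorm (de.1 i) : ℝ) ≤ X ∧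
          ∏ i, (Ideal.absNorm (de.2 i) : ℝ) ≤ X),
        f (𝔴 * ∏ i, (de.1 i ⊓ de.2 i)) ≤
      ∑ 𝔮 ∈ (idealsLE K (Ideal.absNorm 𝔴 * (X * X))).filter (fun 𝔮 => Squarefree 𝔮),
        ((4 : ℝ) ^ k) ^ omegaI 𝔮 * f 𝔮 := by
  classical
  set P := ((boxG K k 𝔴 B) ×ˢ (boxG K k 𝔴 B)).filter (fun de =>
    (∀ p : OffDiag k, de.1 p.1.1 ⊔ de.2 p.1.2 = ⊤) ∧ ∏ i, (Ideal.absNorm (de.1 i) : ℝ) ≤ X ∧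
      ∏ i, (Ideal.absNorm (de.2 i) : ℝ) ≤ X) with hP
  set g : (Fin k → Ideal (𝓞 K)) × (Fin k → Ideal (𝓞 K)) → Ideal (𝓞 K) :=
    fun de => 𝔴 * ∏ i, (de.1 i ⊓ de.2 i) with hg
  have h𝔴0 : 𝔴 ≠ ⊥ := fun h0 => h𝔴.ne_zero (h0.trans Ideal.zero_eq_bot.symm)
  have hmemP : ∀ de ∈ P, IsGood 𝔴 de.1 ∧ IsGood 𝔴 de.2 ∧
      (∀ p : OffDiag k, de.1 p.1.1 ⊔ de.2 p.1.2 = ⊤) ∧ ∏ i, (Ideal.absNorm (de.1 i) : ℝ) ≤ X ∧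
        ∏ i, (Ideal.absNorm (de.2 i) : ℝ) ≤ X := by
    intro de hde
    rw [hP, Finset.mem_filter, Finset.mem_product] at hde
    exact ⟨(mem_boxG.1 hde.1.1).2, (mem_boxG.1 hde.1.2).2, hde.2.1, hde.2.2⟩
  -- the image lies in the squarefree `𝔮` with `0 < N𝔮 ≤ N𝔴 X²`
  have himage : P.image g ⊆ (idealsLE K (Ideal.absNorm 𝔴 * (X * X))).filter (fun 𝔮 => Squarefree 𝔮) := by
    intro 𝔮 hq
    rw [Finset.mem_image] at hq
    obtain ⟨de, hde, rfl⟩ := hq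
    obtain ⟨hd, he, hc, hdX, heX⟩ := hmemP de hde
    have hsq := squarefree_qmod h𝔴 hd he hc
    rw [Finset.mem_filter, mem_idealsLE]
    refine ⟨⟨fun h0 => hsq.ne_zero (h0.trans Ideal.zero_eq_bot.symm), ?_⟩, hsq⟩
    refine (absNorm_qmod_le 𝔴 hd.squarefree_apply he.squarefree_apply).trans ?_
    refine mul_le_mul_of_nonneg_left ?_ (Nat.cast_nonneg _)
    exact mul_le_mul hdX heX (Finset.prod_nonneg fun i _ => Nat.cast_nonneg _)
      (le_trans (Finset.prod_nonneg fun i _ => Nat.cast_nonneg _) hdX)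
  -- the fibres have at most `τ(𝔮)^{2k} ≤ (4^k)^{ω(𝔮)}` elements
  have hfibre : ∀ 𝔮 ∈ P.image g, ((P.filter fun de => g de = 𝔮).card : ℝ) ≤ ((4 : ℝ) ^ k) ^ omegaI 𝔮 := by
    intro 𝔮 hq
    have hq' := Finset.mem_filter.1 (himage hq)
    have hsq : Squarefree 𝔮 := hq'.2
    have hq0 : 𝔮 ≠ ⊥ := (mem_idealsLE.1 hq'.1).1
    have hsub : P.filter (fun de => g de = 𝔮) ⊆
        (Fintype.piFinset fun _ : Fin k => idealDivisors K 𝔮) ×ˢ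
          (Fintype.piFinset fun _ : Fin k => idealDivisors K 𝔮) := by
      intro de hde
      rw [Finset.mem_filter] at hde
      obtain ⟨-, hdeq⟩ := hde
      have hdvd : ∀ i, de.1 i ∣ 𝔮 ∧ de.2 i ∣ 𝔮 := by
        intro i
        have hL : de.1 i ⊓ de.2 i ∣ 𝔮 := by
          rw [← hdeq, hg]
          exact (Finset.dvd_prod_of_mem (fun j => de.1 j ⊓ de.2 j) (Finset.mem_univ i)).trans
            (dvd_mul_left _ _)
        exact ⟨(Ideal.dvd_iff_le.2 inf_le_left).trans hL, (Ideal.dvd_iff_le.2 inf_le_right).trans hL⟩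
      rw [Finset.mem_product, Fintype.mem_piFinset, Fintype.mem_piFinset]
      exact ⟨fun i => (mem_idealDivisors hq0).2 (hdvd i).1, fun i => (mem_idealDivisors hq0).2 (hdvd i).2⟩
    have hcard := Finset.card_le_card hsub
    rw [Finset.card_product, Fintype.card_piFinset, Finset.prod_const, Finset.card_univ,
      Fintype.card_fin] at hcard
    have hτ := card_idealDivisors_le_two_pow_omegaI hq0 hsq
    calc ((P.filter fun de => g de = 𝔮).card : ℝ)
        ≤ (((idealDivisors K 𝔮).card ^ k * (idealDivisors K 𝔮).card ^ k : ℕ) : ℝ) := by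
          exact_mod_cast hcard
      _ ≤ (((2 ^ omegaI 𝔮) ^ k * (2 ^ omegaI 𝔮) ^ k : ℕ) : ℝ) := by
          exact_mod_cast Nat.mul_le_mul (Nat.pow_le_pow_left hτ k) (Nat.pow_le_pow_left hτ k)
      _ = ((4 : ℝ) ^ k) ^ omegaI 𝔮 := by
          push_cast
          rw [← pow_mul, ← pow_mul, ← mul_pow, show (2 : ℝ) * 2 = 4 by norm_num, mul_comm]
  -- regroup
  rw [Finset.sum_comp f g]
  calc ∑ 𝔮 ∈ P.image g, (P.filter fun de => g de = 𝔮).card • f 𝔮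
      ≤ ∑ 𝔮 ∈ P.image g, ((4 : ℝ) ^ k) ^ omegaI 𝔮 * f 𝔮 := by
        refine Finset.sum_le_sum fun 𝔮 hq => ?_
        rw [nsmul_eq_mul]
        exact mul_le_mul_of_nonneg_right (hfibre 𝔮 hq) (hf 𝔮)
    _ ≤ _ := Finset.sum_le_sum_of_subset_of_nonneg himage fun 𝔮 _ _ => by
        have := hf 𝔮; positivity

/-! ### The error of Lemma 2.3 regrouped -/

/-- `C_s ≥ 0` for any `ShiftBound` constant (it bounds a cardinality by `C_s` times a positive
quantity). [folklore] -/
theorem ShiftBound.nonneg {h₀ : 𝓞 K} {C_s : ℝ} (hCs : ShiftBound K h₀ C_s) : 0 ≤ C_s := by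
  have h := hCs 1 1 le_rfl 0
  refine nonneg_of_mul_nonneg_left (le_trans (Nat.cast_nonneg _) h) ?_
  positivity

variable (K) in
/-- The error weight attached to a modulus `𝔮`: `𝓔(N;𝔮) + C_s (N^{d−1}/N𝔮 + 1 + (N^d/N𝔮)^{1−1/d})`.
[cite: CastilloEtAl2015, proof of Lemma 2.3] -/
def modErr (N C_s : ℝ) (𝔮 : Ideal (𝓞 K)) : ℝ :=
  primesAErr K N 𝔮 + C_s * (N ^ (finrank ℚ K - 1) / Ideal.absNorm 𝔮 +
    (1 + (N ^ finrank ℚ K / Ideal.absNorm 𝔮) ^ (1 - 1 / (finrank ℚ K : ℝ))))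

/-- `modErr ≥ 0` for `C_s ≥ 0`. [folklore] -/
theorem modErr_nonneg {N : ℝ} (hN : 0 ≤ N) {C_s : ℝ} (hCs : 0 ≤ C_s) (𝔮 : Ideal (𝓞 K)) :
    0 ≤ modErr K N C_s 𝔮 := by
  refine add_nonneg (primesAErr_nonneg _ _) (mul_nonneg hCs (add_nonneg (by positivity) ?_))
  exact add_nonneg zero_le_one (Real.rpow_nonneg (by positivity) _)

/-- `pairErr` in terms of `modErr`: for a compatible pair, `pairErr` is `modErr(𝔴∏[𝔡ᵢ,𝔢ᵢ])` or the
generator count `U`; always `pairErr ≤ [compatible]·modErr(𝔴∏[𝔡ᵢ,𝔢ᵢ]) + U`. [folklore] -/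
theorem pairErr_le (𝔴 : Ideal (𝓞 K)) (h : Fin k → 𝓞 K) {N : ℝ} (hN : 0 ≤ N) (m : Fin k) {C_s C_u : ℝ}
    (hCs : 0 ≤ C_s)
    (hU : 0 ≤ C_u * (1 + Real.log ((2 + CastilloEtAl2015.shiftConst K (h m)) * N)) ^ Units.rank K)
    (𝔡 𝔢 : Fin k → Ideal (𝓞 K)) :
    pairErr K k 𝔴 h N m C_s C_u 𝔡 𝔢 ≤
      (if ∀ p : OffDiag k, 𝔡 p.1.1 ⊔ 𝔢 p.1.2 = ⊤ then modErr K N C_s (𝔴 * ∏ i, (𝔡 i ⊓ 𝔢 i)) else 0) +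
        C_u * (1 + Real.log ((2 + CastilloEtAl2015.shiftConst K (h m)) * N)) ^ Units.rank K := by
  unfold pairErr
  by_cases hc : ∀ p : OffDiag k, 𝔡 p.1.1 ⊔ 𝔢 p.1.2 = ⊤
  · rw [if_pos hc, if_pos hc]
    have hm0 := modErr_nonneg hN hCs (𝔴 * ∏ i, (𝔡 i ⊓ 𝔢 i)) (K := K)
    split_ifs with hm
    · change modErr K N C_s (𝔴 * ∏ i, (𝔡 i ⊓ 𝔢 i)) ≤ _
      linarith
    · linarith
  · rw [if_neg hc, if_neg hc]
    linarith

/-- **Termwise**: `|λ_𝔡λ_𝔢| pairErr(𝔡,𝔢) ≤ λ_max² [compatible, ∏N𝔡ᵢ ≤ X, ∏N𝔢ᵢ ≤ X]·modErr(𝔴∏[𝔡ᵢ,𝔢ᵢ])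
+ λ_max² U` (`λ` vanishes off tuples of norm product `≤ X`; `U` the generator count).
[cite: CastilloEtAl2015, proof of Lemma 2.3 (regrouping by 𝔮)] -/
theorem abs_lam_mul_pairErr_le [IsTotallyReal K] {𝔴 : Ideal (𝓞 K)} (h𝔴0 : 𝔴 ≠ ⊥) {B X : ℝ}
    {y : (Fin k → Ideal (𝓞 K)) → ℝ} (hy : SupportedOn K k 𝔴 B y)
    (hyX : ∀ 𝔯, y 𝔯 ≠ 0 → ∏ i, (Ideal.absNorm (𝔯 i) : ℝ) ≤ X) {lmax : ℝ}
    (hlmax : ∀ 𝔡, |lam K k B y 𝔡| ≤ lmax) (h : Fin k → 𝓞 K) {N : ℝ} (hN : 1 ≤ N) (m : Fin k)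
    {C_s : ℝ} (hCs : ShiftBound K (h m) C_s) {C_u : ℝ} (hCu : GeneratorCount K C_u)
    {𝔡 𝔢 : Fin k → Ideal (𝓞 K)} (hd : 𝔡 ∈ boxG K k 𝔴 B) (he : 𝔢 ∈ boxG K k 𝔴 B) :
    |lam K k B y 𝔡| * |lam K k B y 𝔢| * pairErr K k 𝔴 h N m C_s C_u 𝔡 𝔢 ≤
      lmax ^ 2 * (if (∀ p : OffDiag k, 𝔡 p.1.1 ⊔ 𝔢 p.1.2 = ⊤) ∧
            ∏ i, (Ideal.absNorm (𝔡 i) : ℝ) ≤ X ∧ ∏ i, (Ideal.absNorm (𝔢 i) : ℝ) ≤ X then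
          modErr K N C_s (𝔴 * ∏ i, (𝔡 i ⊓ 𝔢 i)) else 0) +
        lmax ^ 2 * (if ∏ i, (Ideal.absNorm (𝔡 i) : ℝ) ≤ X ∧ ∏ i, (Ideal.absNorm (𝔢 i) : ℝ) ≤ X then
          C_u * (1 + Real.log ((2 + CastilloEtAl2015.shiftConst K (h m)) * N)) ^ Units.rank K
          else 0) := by
  have hl0 : 0 ≤ lmax := le_trans (abs_nonneg _) (hlmax fun _ => ⊥)
  have hCs0 : 0 ≤ C_s := hCs.nonneg
  have hU0 : 0 ≤ C_u * (1 + Real.log ((2 + CastilloEtAl2015.shiftConst K (h m)) * N)) ^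
      Units.rank K := le_trans (Nat.cast_nonneg _)
    (cntP_le_of_apply_ne_top hCu 𝔴 h (0 : 𝓞 K) hN m (𝔡 := fun _ => ⊥) (by simp) fun _ => ⊥)
  have hdG := (mem_boxG.1 hd).2
  have heG := (mem_boxG.1 he).2
  have hpe0 : 0 ≤ pairErr K k 𝔴 h N m C_s C_u 𝔡 𝔢 := pairErr_nonneg h𝔴0 h hN m hCs hCu hdG heG
  have hN0 : 0 ≤ N := by linarith
  have hm0 := modErr_nonneg hN0 hCs0 (𝔴 * ∏ i, (𝔡 i ⊓ 𝔢 i)) (K := K)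
  have hite0 : 0 ≤ (if (∀ p : OffDiag k, 𝔡 p.1.1 ⊔ 𝔢 p.1.2 = ⊤) ∧
      ∏ i, (Ideal.absNorm (𝔡 i) : ℝ) ≤ X ∧ ∏ i, (Ideal.absNorm (𝔢 i) : ℝ) ≤ X then
      modErr K N C_s (𝔴 * ∏ i, (𝔡 i ⊓ 𝔢 i)) else 0) := by
    split_ifs
    · exact hm0
    · exact le_rfl
  have hiteU0 : 0 ≤ (if ∏ i, (Ideal.absNorm (𝔡 i) : ℝ) ≤ X ∧ ∏ i, (Ideal.absNorm (𝔢 i) : ℝ) ≤ X then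
      C_u * (1 + Real.log ((2 + CastilloEtAl2015.shiftConst K (h m)) * N)) ^ Units.rank K else 0) := by
    split_ifs
    · exact hU0
    · exact le_rfl
  by_cases hl : lam K k B y 𝔡 = 0 ∨ lam K k B y 𝔢 = 0
  · have : |lam K k B y 𝔡| * |lam K k B y 𝔢| = 0 := by
      rcases hl with h0 | h0 <;> simp [h0]
    rw [this, zero_mul]
    exact add_nonneg (mul_nonneg (sq_nonneg _) hite0) (mul_nonneg (sq_nonneg _) hiteU0)
  push Not at hl
  have hdX := (prod_le_of_lam_ne_zero hy hyX hl.1).2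
  have heX := (prod_le_of_lam_ne_zero hy hyX hl.2).2
  rw [if_pos (show ∏ i, (Ideal.absNorm (𝔡 i) : ℝ) ≤ X ∧ ∏ i, (Ideal.absNorm (𝔢 i) : ℝ) ≤ X from
    ⟨hdX, heX⟩)]
  have hll : |lam K k B y 𝔡| * |lam K k B y 𝔢| ≤ lmax ^ 2 := by
    rw [sq]; exact mul_le_mul (hlmax 𝔡) (hlmax 𝔢) (abs_nonneg _) hl0
  have hpe := pairErr_le 𝔴 h hN0 m hCs0 hU0 𝔡 𝔢 (k := k) (C_u := C_u)
  have hite : (if ∀ p : OffDiag k, 𝔡 p.1.1 ⊔ 𝔢 p.1.2 = ⊤ then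
      modErr K N C_s (𝔴 * ∏ i, (𝔡 i ⊓ 𝔢 i)) else 0) =
      (if (∀ p : OffDiag k, 𝔡 p.1.1 ⊔ 𝔢 p.1.2 = ⊤) ∧
        ∏ i, (Ideal.absNorm (𝔡 i) : ℝ) ≤ X ∧ ∏ i, (Ideal.absNorm (𝔢 i) : ℝ) ≤ X then
        modErr K N C_s (𝔴 * ∏ i, (𝔡 i ⊓ 𝔢 i)) else 0) := by
    by_cases hc : ∀ p : OffDiag k, 𝔡 p.1.1 ⊔ 𝔢 p.1.2 = ⊤
    · rw [if_pos hc, if_pos ⟨hc, hdX, heX⟩]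
    · rw [if_neg hc, if_neg (fun h' => hc h'.1)]
  rw [hite] at hpe
  calc |lam K k B y 𝔡| * |lam K k B y 𝔢| * pairErr K k 𝔴 h N m C_s C_u 𝔡 𝔢
      ≤ lmax ^ 2 * pairErr K k 𝔴 h N m C_s C_u 𝔡 𝔢 := mul_le_mul_of_nonneg_right hll hpe0
    _ ≤ lmax ^ 2 * ((if (∀ p : OffDiag k, 𝔡 p.1.1 ⊔ 𝔢 p.1.2 = ⊤) ∧
          ∏ i, (Ideal.absNorm (𝔡 i) : ℝ) ≤ X ∧ ∏ i, (Ideal.absNorm (𝔢 i) : ℝ) ≤ X then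
          modErr K N C_s (𝔴 * ∏ i, (𝔡 i ⊓ 𝔢 i)) else 0) +
        C_u * (1 + Real.log ((2 + CastilloEtAl2015.shiftConst K (h m)) * N)) ^ Units.rank K) :=
        mul_le_mul_of_nonneg_left hpe (sq_nonneg _)
    _ = _ := by ring

/-- **The error of Lemma 2.3 regrouped by the modulus** (display after (eq:S2mainerror): "the error
term contributes no more than `y_max² (log R)^{2k} ∑_{|𝔮|<R²|𝔴|} μ(𝔮)² τ_{3k}(𝔮) 𝓔(N;𝔮)`", here with
the shift term and the slot-`m` generator count kept): with `|λ_𝔡| ≤ λ_max` and `λ` living on tuples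
of norm product `≤ X` (of which there are `≤ X (∑_{G1} 1/N𝔞)^k`),
`∑_{𝔡,𝔢 good} |λ_𝔡λ_𝔢| pairErr(𝔡,𝔢) ≤ λ_max² ∑_{𝔮 sqfree, N𝔮 ≤ N𝔴X²} (4^k)^{ω(𝔮)} modErr(𝔮)
  + λ_max² (X (∑_{G1} 1/N𝔞)^k)² C_u (1 + log((2 + c)N))^{rank}`.
[cite: CastilloEtAl2015, proof of Lemma 2.3 (regrouping by 𝔮)] -/
theorem sum_lam_pairErr_le [IsTotallyReal K] {𝔴 : Ideal (𝓞 K)} (h𝔴 : Squarefree 𝔴) {B X : ℝ}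
    (hX0 : 0 ≤ X) {y : (Fin k → Ideal (𝓞 K)) → ℝ} (hy : SupportedOn K k 𝔴 B y)
    (hyX : ∀ 𝔯, y 𝔯 ≠ 0 → ∏ i, (Ideal.absNorm (𝔯 i) : ℝ) ≤ X) {lmax : ℝ}
    (hlmax : ∀ 𝔡, |lam K k B y 𝔡| ≤ lmax) (h : Fin k → 𝓞 K) {N : ℝ} (hN : 1 ≤ N) (m : Fin k)
    {C_s : ℝ} (hCs : ShiftBound K (h m) C_s) {C_u : ℝ} (hCu : GeneratorCount K C_u) :
    ∑ 𝔡 ∈ boxG K k 𝔴 B, ∑ 𝔢 ∈ boxG K k 𝔴 B,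
        |lam K k B y 𝔡| * |lam K k B y 𝔢| * pairErr K k 𝔴 h N m C_s C_u 𝔡 𝔢 ≤
      lmax ^ 2 * ∑ 𝔮 ∈ (idealsLE K (Ideal.absNorm 𝔴 * (X * X))).filter (fun 𝔮 => Squarefree 𝔮),
          ((4 : ℝ) ^ k) ^ omegaI 𝔮 * modErr K N C_s 𝔮 +
        lmax ^ 2 * (X * (∑ 𝔞 ∈ G1 K 𝔴 B, 1 / (Ideal.absNorm 𝔞 : ℝ)) ^ k) ^ 2 *
          (C_u * (1 + Real.log ((2 + CastilloEtAl2015.shiftConst K (h m)) * N)) ^ Units.rank K) := by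
  classical
  have h𝔴0 : 𝔴 ≠ ⊥ := fun h0 => h𝔴.ne_zero (h0.trans Ideal.zero_eq_bot.symm)
  have hCs0 : 0 ≤ C_s := hCs.nonneg
  have hN0 : 0 ≤ N := by linarith
  have hU0 : 0 ≤ C_u * (1 + Real.log ((2 + CastilloEtAl2015.shiftConst K (h m)) * N)) ^
      Units.rank K := le_trans (Nat.cast_nonneg _)
    (cntP_le_of_apply_ne_top hCu 𝔴 h (0 : 𝓞 K) hN m (𝔡 := fun _ => ⊥) (by simp) fun _ => ⊥)
  obtain ⟨U, hU⟩ : ∃ x : ℝ, x = C_u * (1 + Real.log ((2 + CastilloEtAl2015.shiftConst K (h m)) * N)) ^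
      Units.rank K := ⟨_, rfl⟩
  rw [← hU] at hU0 ⊢
  have hsum := Finset.sum_le_sum fun 𝔡 hd => Finset.sum_le_sum fun 𝔢 he =>
    abs_lam_mul_pairErr_le h𝔴0 hy hyX hlmax h hN m hCs hCu hd he
  simp only [← hU] at hsum
  refine hsum.trans ?_
  simp only [Finset.sum_add_distrib]
  refine add_le_add ?_ ?_
  · have h1 := sum_pairs_le_sum_moduli (k := k) (B := B) (X := X) h𝔴 (f := modErr K N C_s)
      (modErr_nonneg hN0 hCs0)
    rw [Finset.sum_filter, Finset.sum_product] at h1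
    simp only [← Finset.mul_sum]
    exact mul_le_mul_of_nonneg_left h1 (sq_nonneg _)
  · -- the generator-count part: `#{𝔡 : ∏N𝔡ᵢ ≤ X}² U`
    set F := (boxG K k 𝔴 B).filter (fun 𝔡 => ∏ i, (Ideal.absNorm (𝔡 i) : ℝ) ≤ X) with hF
    have hcard : (F.card : ℝ) ≤ X * (∑ 𝔞 ∈ G1 K 𝔴 B, 1 / (Ideal.absNorm 𝔞 : ℝ)) ^ k :=
      card_boxG_prod_le 𝔴 B hX0
    have hinner : ∀ 𝔡 ∈ boxG K k 𝔴 B, ∑ 𝔢 ∈ boxG K k 𝔴 B,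
        lmax ^ 2 * (if ∏ i, (Ideal.absNorm (𝔡 i) : ℝ) ≤ X ∧ ∏ i, (Ideal.absNorm (𝔢 i) : ℝ) ≤ X then
          U else 0) =
        (if ∏ i, (Ideal.absNorm (𝔡 i) : ℝ) ≤ X then 1 else 0) * (lmax ^ 2 * (F.card * U)) := by
      intro 𝔡 _
      by_cases hPd : ∏ i, (Ideal.absNorm (𝔡 i) : ℝ) ≤ X
      · simp only [hPd, true_and, if_true, one_mul]
        rw [← Finset.mul_sum, ← Finset.sum_filter, Finset.sum_const, nsmul_eq_mul]
      · simp only [hPd, false_and, if_false, mul_zero, Finset.sum_const_zero, zero_mul]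
    rw [Finset.sum_congr rfl hinner, ← Finset.sum_mul, Finset.sum_boole]
    have hF0 : (0 : ℝ) ≤ F.card := Nat.cast_nonneg _
    calc (F.card : ℝ) * (lmax ^ 2 * (F.card * U)) = lmax ^ 2 * (F.card : ℝ) ^ 2 * U := by ring
      _ ≤ lmax ^ 2 * (X * (∑ 𝔞 ∈ G1 K 𝔴 B, 1 / (Ideal.absNorm 𝔞 : ℝ)) ^ k) ^ 2 * U := by
          refine mul_le_mul_of_nonneg_right (mul_le_mul_of_nonneg_left
            (pow_le_pow_left₀ hF0 hcard 2) (sq_nonneg _)) hU0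

/-! ### The trivial bound `𝓔(N; 𝔮) ≪ N^d/φ(𝔮)` -/

/-- `1 + u^e ≤ 2u` for `u ≥ 1`, `0 ≤ e ≤ 1`. [folklore] -/
theorem one_add_rpow_le_two_mul {u e : ℝ} (hu : 1 ≤ u) (he1 : e ≤ 1) :
    1 + u ^ e ≤ 2 * u := by
  have : u ^ e ≤ u := by
    calc u ^ e ≤ u ^ (1 : ℝ) := Real.rpow_le_rpow_of_exponent_le hu he1
      _ = u := Real.rpow_one u
  linarith

/-- The class count of `A(N)` as a `Nat.card`. [folklore] -/
theorem card_filter_sub_mem_eq_natCard (N : ℝ) (𝔮 : Ideal (𝓞 K)) (a : 𝓞 K) :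
    ((regionF K N).filter fun α => α - a ∈ 𝔮).card =
      Nat.card {α : 𝓞 K // α ∈ CastilloEtAl2015.box K N ∧ α - a ∈ 𝔮} := by
  rw [← Nat.card_eq_finsetCard]
  exact Nat.card_congr (Equiv.subtypeEquivRight fun α => by rw [Finset.mem_filter, mem_regionF])

/-- **The class count is `≪ N^d/N𝔮`** for `N𝔮 ≤ N^d` (`N ≥ 1`): from `UniformCount`,
`#{α ∈ A(N) : α ≡ a (𝔮)} ≤ ((2^d−1)/√|D_K| + 2|C|) N^d/N𝔮`. [cite: CastilloEtAl2015, §2.1] -/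
theorem card_class_le_of_uniformCount {C : ℝ} (hC : UniformCount K C) {𝔮 : Ideal (𝓞 K)}
    (h𝔮 : 𝔮 ≠ ⊥) {N : ℝ} (hN : 1 ≤ N) (hqN : (Ideal.absNorm 𝔮 : ℝ) ≤ N ^ finrank ℚ K) (a : 𝓞 K) :
    ((((regionF K N).filter fun α => α - a ∈ 𝔮).card : ℝ)) ≤
      ((2 ^ finrank ℚ K - 1) / √|(discr K : ℝ)| + 2 * |C|) * (N ^ finrank ℚ K / Ideal.absNorm 𝔮) := by
  have hq0' : 𝔮 ∈ (Ideal (𝓞 K))⁰ := mem_nonZeroDivisors_of_ne_zero (by rwa [Ne, Ideal.zero_eq_bot])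
  have h := hC ⟨𝔮, hq0'⟩ N hN a
  simp only at h
  rw [card_filter_sub_mem_eq_natCard]
  have hn0 : (0 : ℝ) < Ideal.absNorm 𝔮 := by
    exact_mod_cast Nat.pos_of_ne_zero (by rwa [Ne, Ideal.absNorm_eq_zero_iff])
  have hu1 : 1 ≤ N ^ finrank ℚ K / Ideal.absNorm 𝔮 := by
    rw [le_div_iff₀ hn0, one_mul]; exact hqN
  have hd1 : (1 : ℝ) ≤ finrank ℚ K := by exact_mod_cast (finrank_pos : 0 < finrank ℚ K)
  have he1 : 1 - 1 / (finrank ℚ K : ℝ) ≤ 1 := by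
    have : 0 ≤ 1 / (finrank ℚ K : ℝ) := by positivity
    linarith
  have h1 := (abs_le.1 h).2
  have h2 : C * (1 + (N ^ finrank ℚ K / Ideal.absNorm 𝔮) ^ (1 - 1 / (finrank ℚ K : ℝ))) ≤
      |C| * (2 * (N ^ finrank ℚ K / Ideal.absNorm 𝔮)) := by
    calc C * (1 + (N ^ finrank ℚ K / Ideal.absNorm 𝔮) ^ (1 - 1 / (finrank ℚ K : ℝ)))
        ≤ |C| * (1 + (N ^ finrank ℚ K / Ideal.absNorm 𝔮) ^ (1 - 1 / (finrank ℚ K : ℝ))) :=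
          mul_le_mul_of_nonneg_right (le_abs_self C)
            (add_nonneg zero_le_one (Real.rpow_nonneg (by positivity) _))
      _ ≤ |C| * (2 * (N ^ finrank ℚ K / Ideal.absNorm 𝔮)) :=
          mul_le_mul_of_nonneg_left (one_add_rpow_le_two_mul hu1 he1) (abs_nonneg C)
  have h3 : (2 ^ finrank ℚ K - 1) * N ^ finrank ℚ K / (Ideal.absNorm 𝔮 * √|(discr K : ℝ)|) =
      (2 ^ finrank ℚ K - 1) / √|(discr K : ℝ)| * (N ^ finrank ℚ K / Ideal.absNorm 𝔮) := by
    have hD : (0 : ℝ) < √|(discr K : ℝ)| :=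
      Real.sqrt_pos.2 (abs_pos.2 (Int.cast_ne_zero.2 (discr_ne_zero K)))
    field_simp
  rw [h3] at h1
  linarith

/-- **The trivial bound** ("Using the trivial bound `𝓔(N;𝔮) ≪ |A(N)|/φ(𝔮)`", proof of Lemma 2.3):
for `𝔮 ≠ 0` with `N𝔮 ≤ N^d` and `N ≥ 1`,
`𝓔(N; 𝔮) ≤ 2((2^d−1)/√|D_K| + 2|C|) N^d/φ(𝔮)` (`C` any `UniformCount` constant).
[cite: CastilloEtAl2015, proof of Lemma 2.3 (the trivial bound 𝓔(N;𝔮) ≪ |A(N)|/φ(𝔮))] -/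
theorem primesAErr_le_of_uniformCount {C : ℝ} (hC : UniformCount K C) {𝔮 : Ideal (𝓞 K)}
    (h𝔮 : 𝔮 ≠ ⊥) {N : ℝ} (hN : 1 ≤ N) (hqN : (Ideal.absNorm 𝔮 : ℝ) ≤ N ^ finrank ℚ K) :
    primesAErr K N 𝔮 ≤
      2 * ((2 ^ finrank ℚ K - 1) / √|(discr K : ℝ)| + 2 * |C|) * (N ^ finrank ℚ K / idealTotient K 𝔮) := by
  set M : ℝ := (2 ^ finrank ℚ K - 1) / √|(discr K : ℝ)| + 2 * |C| with hM
  have hM0 : 0 ≤ M := by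
    have : (1 : ℝ) ≤ 2 ^ finrank ℚ K := one_le_pow₀ (by norm_num)
    have h1 : 0 ≤ (2 ^ finrank ℚ K - 1) / √|(discr K : ℝ)| := div_nonneg (by linarith) (Real.sqrt_nonneg _)
    positivity
  haveI : Finite (𝓞 K ⧸ 𝔮) := Ideal.finiteQuotientOfFreeOfNeBot 𝔮 h𝔮
  have hφ : 0 < idealTotient K 𝔮 := idealTotient_pos h𝔮
  have hφn : idealTotient K 𝔮 ≤ Ideal.absNorm 𝔮 := idealTotient_le_absNorm 𝔮
  have hN0 : 0 < N := by linarith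
  -- `|A(N)| ≤ M N^d` (the class bound at `𝔮 = (1)`, `a = 0`)
  have hA : (cardA K N : ℝ) ≤ M * N ^ finrank ℚ K := by
    have h := card_class_le_of_uniformCount hC (𝔮 := ⊤) (by simp) hN
      (by rw [Ideal.absNorm_top, Nat.cast_one]; exact one_le_pow₀ hN) 0
    have hfil : ((regionF K N).filter fun α => α - 0 ∈ (⊤ : Ideal (𝓞 K))) = regionF K N :=
      Finset.filter_true_of_mem fun α _ => Submodule.mem_top
    rw [hfil, Ideal.absNorm_top, Nat.cast_one, div_one] at h
    exact h
  have hdiv : N ^ finrank ℚ K / (Ideal.absNorm 𝔮 : ℝ) ≤ N ^ finrank ℚ K / idealTotient K 𝔮 :=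
    div_le_div_of_nonneg_left (by positivity) hφ hφn
  refine ciSup_le fun u => ?_
  obtain ⟨a, ha⟩ := Ideal.Quotient.mk_surjective (u : 𝓞 K ⧸ 𝔮)
  have hP : (primesAModQ K N 𝔮 (u : 𝓞 K ⧸ 𝔮) : ℝ) ≤ M * (N ^ finrank ℚ K / idealTotient K 𝔮) := by
    rw [← ha]
    calc (primesAModQ K N 𝔮 (Ideal.Quotient.mk 𝔮 a) : ℝ)
        ≤ ((regionF K N).filter fun α => α - a ∈ 𝔮).card := by
          exact_mod_cast primesAModQ_le_card_class N 𝔮 a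
      _ ≤ M * (N ^ finrank ℚ K / Ideal.absNorm 𝔮) := card_class_le_of_uniformCount hC h𝔮 hN hqN a
      _ ≤ M * (N ^ finrank ℚ K / idealTotient K 𝔮) := mul_le_mul_of_nonneg_left hdiv hM0
  have hQ : (primesA K N : ℝ) / idealTotient K 𝔮 ≤ M * (N ^ finrank ℚ K / idealTotient K 𝔮) := by
    rw [← mul_div_assoc]
    refine div_le_div_of_nonneg_right ?_ hφ.le
    exact le_trans (by exact_mod_cast primesA_le_cardA N) hA
  have hP0 : (0 : ℝ) ≤ primesAModQ K N 𝔮 (u : 𝓞 K ⧸ 𝔮) := Nat.cast_nonneg _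
  have hQ0 : (0 : ℝ) ≤ primesA K N / idealTotient K 𝔮 := div_nonneg (Nat.cast_nonneg _) hφ.le
  rw [abs_le]
  constructor <;> linarith

/-! ### Euler products: `∑_{𝔮 sqfree, N𝔮 ≤ x} c^{ω(𝔮)}/φ(𝔮) ≪ (log x)^c` -/

/-- `φ(∏_{𝔭 ∈ S} 𝔭) = ∏_{𝔭 ∈ S} (N𝔭 − 1)`. [folklore] -/
theorem idealTotient_prodIdeal (S : Finset (HeightOneSpectrum (𝓞 K))) :
    idealTotient K (prodIdeal S) = ∏ v ∈ S, ((Ideal.absNorm v.asIdeal : ℝ) - 1) := by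
  have hsq : Squarefree (prodIdeal S) := by
    rw [UniqueFactorizationMonoid.squarefree_iff_nodup_normalizedFactors (prodIdeal_ne_zero S),
      normalizedFactors_prodIdeal]
    exact (Multiset.Nodup.map (fun v w h => HeightOneSpectrum.ext h) S.nodup)
  rw [idealTotient_of_squarefree hsq, normalizedFactors_prodIdeal]
  have : (Multiset.map HeightOneSpectrum.asIdeal S.val).toFinset = S.image HeightOneSpectrum.asIdeal := by
    ext I; simp [Finset.mem_image]
  rw [this, Finset.prod_image fun v _ w _ h => HeightOneSpectrum.ext h]

/-- **`∑_{𝔮 squarefree, 0 < N𝔮 ≤ x} c^{ω(𝔮)}/φ(𝔮) ≤ C (log x)^c`** (`x ≥ 2`, `c ≥ 0`): an Euler product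
`∏_{N𝔭 ≤ x} (1 + c/(N𝔭 − 1))` and Mertens' theorem for `K`
(`SquarefreeIdeal.sum_squarefree_le_log_pow`). [cite: CastilloEtAl2015, proof of Lemma 2.2 (estimation of sums by Euler products)] -/
theorem sum_pow_omegaI_div_idealTotient_le {c : ℝ} (hc : 0 ≤ c) :
    ∃ C : ℝ, ∀ x : ℝ, 2 ≤ x →
      ∑ 𝔮 ∈ (idealsLE K x).filter (fun 𝔮 => Squarefree 𝔮), c ^ omegaI 𝔮 / idealTotient K 𝔮 ≤
        C * Real.log x ^ c := by
  obtain ⟨C, hC⟩ := sum_squarefree_le_log_pow K hc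
  refine ⟨C, fun x hx => hC x hx _ (fun 𝔮 => c ^ omegaI 𝔮 / idealTotient K 𝔮) (fun I hI => ?_)
    (fun S => ?_)⟩
  · rw [Finset.mem_filter, mem_idealsLE] at hI
    exact ⟨by rw [Ne, Ideal.zero_eq_bot]; exact hI.1.1, hI.2, hI.1.2⟩
  · rw [omegaI_prodIdeal, idealTotient_prodIdeal, Finset.prod_div_distrib, Finset.prod_const]

/-! ### The level-of-distribution step -/

/-- **The level-of-distribution step of Lemma 2.3** ("Using the trivial bound `𝓔(N;𝔮) ≪ |A(N)|/φ(𝔮)`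
along with the Cauchy–Schwarz inequality, we therefore find that
`∑ μ(𝔮)²τ_{3k}(𝔮)𝓔(N;𝔮) ≪ (∑ μ²τ²_{3k} |A(N)|/φ(𝔮))^{1/2} (∑ μ² 𝓔(N;𝔮))^{1/2} ≪ |A(N)|/(log N)^B`"):
if `P` has level of distribution `θ` (totally real `K`), then for every `c ≥ 0` and `A > 0` there
are `C, N₀` with
`∑_{𝔮 sqfree, N𝔮 ≤ Q} c^{ω(𝔮)} 𝓔(N; 𝔮) ≤ C N^d/(log N)^A` for all `N ≥ N₀`, `Q ≤ |A(N)|^θ`, `Q ≤ N^d`.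
[cite: CastilloEtAl2015, proof of Lemma 2.3 (Cauchy–Schwarz and the level of distribution)] -/
theorem PrimesHaveLevel.sum_pow_omegaI_mul_primesAErr_le [IsTotallyReal K] {θ : ℝ}
    (hθ : PrimesHaveLevel K θ) {c : ℝ} (hc : 0 ≤ c) {A : ℝ} (hA : 0 < A) :
    ∃ C N₀ : ℝ, ∀ N : ℝ, N₀ ≤ N → ∀ Q : ℝ, Q ≤ (cardA K N : ℝ) ^ θ → Q ≤ N ^ finrank ℚ K →
      ∑ 𝔮 ∈ (idealsLE K Q).filter (fun 𝔮 => Squarefree 𝔮), c ^ omegaI 𝔮 * primesAErr K N 𝔮 ≤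
        C * N ^ finrank ℚ K / Real.log N ^ A := by
  obtain ⟨Cu, hCu⟩ := exists_uniformCount (K := K)
  set d : ℕ := finrank ℚ K with hd
  have hd1 : 1 ≤ d := finrank_pos
  have hdR : (1 : ℝ) ≤ d := by exact_mod_cast hd1
  set M : ℝ := (2 ^ d - 1) / √|(discr K : ℝ)| + 2 * |Cu| with hM
  have hM0 : 0 ≤ M := by
    have : (1 : ℝ) ≤ 2 ^ d := one_le_pow₀ (by norm_num)
    have h1 : 0 ≤ (2 ^ d - 1) / √|(discr K : ℝ)| := div_nonneg (by linarith) (Real.sqrt_nonneg _)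
    positivity
  obtain ⟨C₁, hC₁⟩ := sum_pow_omegaI_div_idealTotient_le (K := K) (c := c ^ 2) (by positivity)
  obtain ⟨C₂, N₀, hC₂⟩ := hθ (2 * A + c ^ 2) (by positivity)
  -- `C₁ ≥ 0`
  have hC₁0 : 0 ≤ C₁ := by
    have h := hC₁ 2 le_rfl
    have hs : 0 ≤ ∑ 𝔮 ∈ (idealsLE K 2).filter (fun 𝔮 => Squarefree 𝔮), (c ^ 2) ^ omegaI 𝔮 / idealTotient K 𝔮 :=
      Finset.sum_nonneg fun 𝔮 hq => div_nonneg (by positivity)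
        (idealTotient_pos (mem_idealsLE.1 (Finset.mem_filter.1 hq).1).1).le
    have hl : 0 < Real.log 2 ^ (c ^ 2) := Real.rpow_pos_of_pos (Real.log_pos (by norm_num)) _
    nlinarith
  set Cf : ℝ := 2 * M * C₁ * (d : ℝ) ^ (c ^ 2) * (|C₂| * M) with hCf
  have hCf0 : 0 ≤ Cf := by rw [hCf]; positivity
  refine ⟨Real.sqrt Cf, max N₀ 2, fun N hN Q hQ hQN => ?_⟩
  have hN₀ : N₀ ≤ N := le_trans (le_max_left _ _) hN
  have hN2 : 2 ≤ N := le_trans (le_max_right _ _) hN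
  have hN1 : 1 ≤ N := by linarith
  have hN0 : 0 < N := by linarith
  have hlogN : 0 < Real.log N := Real.log_pos (by linarith)
  have hlog2N : Real.log 2 ≤ Real.log N := Real.log_le_log (by norm_num) hN2
  set U := (idealsLE K Q).filter (fun 𝔮 => Squarefree 𝔮) with hU
  set E : Ideal (𝓞 K) → ℝ := fun 𝔮 => primesAErr K N 𝔮 with hE
  have hE0 : ∀ 𝔮, 0 ≤ E 𝔮 := fun 𝔮 => primesAErr_nonneg _ _
  -- Cauchy–Schwarz
  have hCS : (∑ 𝔮 ∈ U, c ^ omegaI 𝔮 * E 𝔮) ^ 2 ≤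
      (∑ 𝔮 ∈ U, (c ^ 2) ^ omegaI 𝔮 * E 𝔮) * ∑ 𝔮 ∈ U, E 𝔮 := by
    refine Finset.sum_sq_le_sum_mul_sum_of_sq_le_mul U (fun 𝔮 _ => mul_nonneg (by positivity) (hE0 𝔮))
      (fun 𝔮 _ => hE0 𝔮) (fun 𝔮 _ => le_of_eq ?_)
    rw [← pow_mul, mul_comm 2, pow_mul]
    ring
  -- first factor: trivial bound + Euler product
  have hQ2 : ∀ 𝔮 ∈ U, 𝔮 ≠ ⊥ ∧ (Ideal.absNorm 𝔮 : ℝ) ≤ N ^ d := fun 𝔮 hq => by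
    have h := mem_idealsLE.1 (Finset.mem_filter.1 hq).1
    exact ⟨h.1, h.2.trans hQN⟩
  have hfirst : ∑ 𝔮 ∈ U, (c ^ 2) ^ omegaI 𝔮 * E 𝔮 ≤
      2 * M * N ^ d * (C₁ * ((d : ℝ) * Real.log N) ^ (c ^ 2)) := by
    have hstep : ∀ 𝔮 ∈ U, (c ^ 2) ^ omegaI 𝔮 * E 𝔮 ≤
        2 * M * N ^ d * ((c ^ 2) ^ omegaI 𝔮 / idealTotient K 𝔮) := fun 𝔮 hq => by
      have h := primesAErr_le_of_uniformCount hCu (hQ2 𝔮 hq).1 hN1 (hQ2 𝔮 hq).2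
      calc (c ^ 2) ^ omegaI 𝔮 * E 𝔮 ≤ (c ^ 2) ^ omegaI 𝔮 * (2 * M * (N ^ d / idealTotient K 𝔮)) :=
            mul_le_mul_of_nonneg_left h (by positivity)
        _ = 2 * M * N ^ d * ((c ^ 2) ^ omegaI 𝔮 / idealTotient K 𝔮) := by ring
    refine (Finset.sum_le_sum hstep).trans ?_
    rw [← Finset.mul_sum]
    refine mul_le_mul_of_nonneg_left ?_ (by positivity)
    -- enlarge the range to `max Q 2 ≤ N^d ∨ 2`, then the Euler product at `x = max (N^d) 2 = N^d`
    have hNd2 : (2 : ℝ) ≤ N ^ d := by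
      calc (2 : ℝ) ≤ N := hN2
        _ = N ^ 1 := (pow_one N).symm
        _ ≤ N ^ d := pow_le_pow_right₀ hN1 hd1
    have hsub : U ⊆ (idealsLE K (N ^ d)).filter (fun 𝔮 => Squarefree 𝔮) := by
      intro 𝔮 hq
      have h := Finset.mem_filter.1 hq
      have h' := mem_idealsLE.1 h.1
      exact Finset.mem_filter.2 ⟨mem_idealsLE.2 ⟨h'.1, h'.2.trans hQN⟩, h.2⟩
    calc ∑ 𝔮 ∈ U, (c ^ 2) ^ omegaI 𝔮 / idealTotient K 𝔮
        ≤ ∑ 𝔮 ∈ (idealsLE K (N ^ d)).filter (fun 𝔮 => Squarefree 𝔮), (c ^ 2) ^ omegaI 𝔮 / idealTotient K 𝔮 :=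
          Finset.sum_le_sum_of_subset_of_nonneg hsub fun 𝔮 hq _ => div_nonneg (by positivity)
            (idealTotient_pos (mem_idealsLE.1 (Finset.mem_filter.1 hq).1).1).le
      _ ≤ C₁ * Real.log (N ^ d) ^ (c ^ 2) := hC₁ _ hNd2
      _ = C₁ * ((d : ℝ) * Real.log N) ^ (c ^ 2) := by rw [Real.log_pow]
  -- second factor: the hypothesis
  have hsecond : ∑ 𝔮 ∈ U, E 𝔮 ≤ |C₂| * M * N ^ d / Real.log N ^ (2 * A + c ^ 2) := by
    have h := hC₂ N hN₀ Q hQ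
    have hsub : U ⊆ idealsLE K Q := Finset.filter_subset _ _
    calc ∑ 𝔮 ∈ U, E 𝔮 ≤ ∑ 𝔮 ∈ idealsLE K Q, E 𝔮 :=
          Finset.sum_le_sum_of_subset_of_nonneg hsub fun 𝔮 _ _ => hE0 𝔮
      _ ≤ C₂ * cardA K N / Real.log N ^ (2 * A + c ^ 2) := h
      _ ≤ |C₂| * (M * N ^ d) / Real.log N ^ (2 * A + c ^ 2) := by
          refine div_le_div_of_nonneg_right ?_ (Real.rpow_nonneg hlogN.le _)
          calc C₂ * (cardA K N : ℝ) ≤ |C₂| * cardA K N :=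
                mul_le_mul_of_nonneg_right (le_abs_self _) (Nat.cast_nonneg _)
            _ ≤ |C₂| * (M * N ^ d) := by
                refine mul_le_mul_of_nonneg_left ?_ (abs_nonneg _)
                have h := card_class_le_of_uniformCount hCu (𝔮 := ⊤) (by simp) hN1
                  (by rw [Ideal.absNorm_top, Nat.cast_one]; exact one_le_pow₀ hN1) 0
                have hfil : ((regionF K N).filter fun α => α - 0 ∈ (⊤ : Ideal (𝓞 K))) = regionF K N :=
                  Finset.filter_true_of_mem fun α _ => Submodule.mem_top
                rw [hfil, Ideal.absNorm_top, Nat.cast_one, div_one] at h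
                exact h
      _ = |C₂| * M * N ^ d / Real.log N ^ (2 * A + c ^ 2) := by ring
  -- combine
  have hprod : (∑ 𝔮 ∈ U, c ^ omegaI 𝔮 * E 𝔮) ^ 2 ≤ Cf * (N ^ d / Real.log N ^ A) ^ 2 := by
    have hf0 : 0 ≤ ∑ 𝔮 ∈ U, (c ^ 2) ^ omegaI 𝔮 * E 𝔮 :=
      Finset.sum_nonneg fun 𝔮 _ => mul_nonneg (by positivity) (hE0 𝔮)
    have hlogpow : ((d : ℝ) * Real.log N) ^ (c ^ 2) = (d : ℝ) ^ (c ^ 2) * Real.log N ^ (c ^ 2) :=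
      Real.mul_rpow (by positivity) hlogN.le
    calc (∑ 𝔮 ∈ U, c ^ omegaI 𝔮 * E 𝔮) ^ 2
        ≤ (∑ 𝔮 ∈ U, (c ^ 2) ^ omegaI 𝔮 * E 𝔮) * ∑ 𝔮 ∈ U, E 𝔮 := hCS
      _ ≤ (2 * M * N ^ d * (C₁ * ((d : ℝ) * Real.log N) ^ (c ^ 2))) *
            (|C₂| * M * N ^ d / Real.log N ^ (2 * A + c ^ 2)) :=
          mul_le_mul hfirst hsecond (Finset.sum_nonneg fun 𝔮 _ => hE0 𝔮) (by positivity)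
      _ = Cf * (N ^ d / Real.log N ^ A) ^ 2 := by
          rw [hlogpow, hCf, div_pow, ← Real.rpow_natCast (Real.log N ^ A) 2, ← Real.rpow_mul hlogN.le,
            Real.rpow_add hlogN, Nat.cast_ofNat]
          field_simp
  have hS0 : 0 ≤ ∑ 𝔮 ∈ U, c ^ omegaI 𝔮 * E 𝔮 :=
    Finset.sum_nonneg fun 𝔮 _ => mul_nonneg (by positivity) (hE0 𝔮)
  have hT0 : 0 ≤ Real.sqrt Cf * (N ^ d / Real.log N ^ A) := by positivity
  have h2 : (∑ 𝔮 ∈ U, c ^ omegaI 𝔮 * E 𝔮) ^ 2 ≤ (Real.sqrt Cf * (N ^ d / Real.log N ^ A)) ^ 2 := by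
    rw [mul_pow, Real.sq_sqrt hCf0]
    exact hprod
  have h3 : ∑ 𝔮 ∈ U, c ^ omegaI 𝔮 * E 𝔮 ≤ Real.sqrt Cf * (N ^ d / Real.log N ^ A) :=
    (pow_le_pow_iff_left₀ hS0 hT0 two_ne_zero).1 h2
  rw [mul_div_assoc]
  exact h3

end Literature.NumberTheory.Sieve.MaynardNF
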